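import Literature.Geometry.Kaehler.ComplexTorusFourierLefschetzLattices
import HarnessLib

/-!
# `Λ` along `φ_L`, and the cokernels of `L_θ` and `Λ_θ` on the integral cohomology of a principally polarised torus:
# `Λ_η(φ_H^* y) = φ_H^*(Λ_{E^*} y)` and `[H^{b+2}(X, ℤ) : θ ∪ Hᵇ(X, ℤ)] = [Hᵐ(X, ℤ) : Λ_θ(H^{m+2}(X, ℤ))]` (`b + 2 + m = 2g`)

[cite: Voisin2002, §6.2.1 Lemma 6.19 (the frame formula for `Λ`); §7.1.2]
[cite: Lange2023AbelianVarietiesComplex, §1.4.2 Lemma 1.4.5 (φ_L has analytic representation φ_H); §2.4.1 (principal: `φ_L` is an isomorphism); §6.2.4 Prop. 6.2.20 (p. 310)]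
[cite: Lang1982AbelianFunctions, Ch. VII §5 Thm. 5.2 (pp. 119–120: `E^*(φ_E x, φ_E y) = E(x, y)`)]
[cite: Polishchuk2007FourierStable, §1 (p. 3)]

Row g50-#8 of the `lit-hodgefound` p09 lineage. SETTING: `X = E/Φ(ℤ^ι)` a complex torus, `η = E` a Riemann form on its lattice,
`X̂ = Ω̄/Λ̂` (`dualPeriod Φ`, `Ω̄ = E →L⋆[ℂ] ℂ`), `E^* = dualForm Φ …` Lang's transport of `E` to `X̂` along the analytic representation
`φ_H : E ⥲ Ω̄` of `φ_L` (`phiHEquiv`, `E^*(φ_H u, φ_H v) = E(u, v)`), `Λ_η = lefschetzDual η m` Voisin's dual Lefschetz operator,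
`L_θ = lefschetzPow η 1` (`x ↦ θ ∧ x`), `Hᵏ(X, ℤ) = integralForms Φ k`.

* §1 **`lefschetzDual_compContinuousLinearMap_equiv`: `Λ_{T^*η′}(T^*γ) = T^*(Λ_{η′} γ)`** for every real-linear isomorphism `T : E ⥲ E′`
  and every non-degenerate `η′` on `E′` (a symplectic frame of `η′` pulls back to a symplectic frame of `T^*η′`; Voisin's frame formula) —
  the two-space form of the tree's `lefschetzDual_compContinuousLinearMap` (automorphisms).
* §2 **`IsRiemannForm.lefschetzDual_compContinuousLinearMap_phiHRep`: `Λ_η(φ_H^* y) = φ_H^*(Λ_{E^*} y)`** — the dual Lefschetz operators of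
  `(X, E)` and `(X̂, E^*)` correspond under `φ_L` (`φ_H^* E^* = E`, Lang).
* §3 **`IsPrincipalPolarization.relIndex_map_lefschetzPow_eq_relIndex_map_lefschetzDual`**: for a PRINCIPAL polarisation `θ` on a torus of
  dimension `g ≥ 2` and `b + 2 + m = 2g`,
  **`[H^{b+2}(X, ℤ) : θ ∪ Hᵇ(X, ℤ)] = [Hᵐ(X, ℤ) : Λ_θ(H^{m+2}(X, ℤ))]`** — the Lefschetz operator and its `sl₂`-partner have cokernels of
  the same order on integral cohomology in complementary degrees. Row g50-#7 gives `[H^{b+2}(X, ℤ) : θ ∪ Hᵇ(X, ℤ)] =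
  [Hᵐ(X̂, ℤ) : d₁d_g·Λ_{E_δ}(H^{m+2}(X̂, ℤ))]` by the Fourier transform; for `d = (1, …, 1)` one has `E_δ = E^*`, `φ_L = ρ(ᵗG)` is an
  isomorphism `X ⥲ X̂` (`det G = 1`) with `φ_L^* H•(X̂, ℤ) = H•(X, ℤ)`, and §2 carries `Λ_{E^*}` to `Λ_θ`.

## References

* [cite: Voisin2002, §6.2.1 Lemma 6.19; §7.1.2]
* [cite: Lange2023AbelianVarietiesComplex, §1.4.2 Lemma 1.4.5, Prop. 1.4.7; §2.4.1; §6.2.4 Prop. 6.2.20 (p. 310)]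
* [cite: Lang1982AbelianFunctions, Ch. VII §5 Thm. 5.2 (pp. 119–120)]
* [cite: Polishchuk2007FourierStable, §1 (p. 3)]
* [cite: McDuffSalamon2017, §2.1 Thm. 2.1.3]
-/

noncomputable section

-- `Module ℂ` / `SMulZeroClass ℂ` synthesis on `E [⋀^Fin k]→L[ℝ] ℂ` (as in `ComplexTorusLefschetzDecomposition`)
set_option maxSynthPendingDepth 3

open Module Function Complex
open Literature.LinearAlgebra.Alternating

namespace Literature.Geometry.Kaehler.ComplexTorus

universe uE

/-! ## §1 `Λ` under a linear isomorphism: `Λ_{T^*η′}(T^*γ) = T^*(Λ_{η′} γ)` -/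

section Functoriality

variable {E : Type*} [NormedAddCommGroup E] [NormedSpace ℂ E] [FiniteDimensional ℂ E]
  {E' : Type*} [NormedAddCommGroup E'] [NormedSpace ℂ E'] [FiniteDimensional ℂ E']

/-- **`Λ_{T^*η′}(T^*γ) = T^*(Λ_{η′} γ)` for a real-linear isomorphism `T : E ⥲ E′`** and a non-degenerate real `2`-form `η′` on `E′`: a
symplectic frame `(e′ᵢ, f′ᵢ)` of `η′` pulls back to the symplectic frame `(T⁻¹e′ᵢ, T⁻¹f′ᵢ)` of `T^*η′`, and Voisin's frame formula
`Λγ(w) = Σᵢ γ(eᵢ, fᵢ, w)` (Lemma 6.19; `Λ` does not depend on the frame) gives the identity. The case `E′ = E`, `T^*η = η` is the tree's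
`lefschetzDual_compContinuousLinearMap`. [cite: Voisin2002, §6.2.1 Lemma 6.19] [cite: McDuffSalamon2017, §2.1 Thm. 2.1.3] -/
theorem lefschetzDual_compContinuousLinearMap_equiv {η' : E' [⋀^Fin 2]→L[ℝ] ℝ}
    (hnd' : ∀ v : E', v ≠ 0 → ∃ w : E', η' ![v, w] ≠ 0) (T : E ≃L[ℝ] E') {m : ℕ} (γ : E' [⋀^Fin (m + 2)]→L[ℝ] ℂ) :
    lefschetzDual (η'.compContinuousLinearMap (T : E →L[ℝ] E')) m (γ.compContinuousLinearMap (T : E →L[ℝ] E')) =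
      (lefschetzDual η' m γ).compContinuousLinearMap (T : E →L[ℝ] E') := by
  obtain ⟨b', hb'⟩ := exists_isSymplecticBasis hnd'
  let b : Module.Basis (Fin (finrank ℂ E') ⊕ Fin (finrank ℂ E')) ℝ E := b'.map T.symm.toLinearEquiv
  have hbT : ∀ x, T (b x) = b' x := fun x ↦ by
    simp [b, Module.Basis.map_apply]
  have hpair : ∀ x y, (η'.compContinuousLinearMap (T : E →L[ℝ] E')) ![b x, b y] = η' ![b' x, b' y] := fun x y ↦ by
    rw [ContinuousAlternatingMap.compContinuousLinearMap_apply]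
    congr 1
    funext k
    refine Fin.cases ?_ (fun k ↦ Fin.cases ?_ (fun k ↦ k.elim0) k) k
    · simp [hbT]
    · simp [hbT]
  have hb : IsSymplecticBasis (η'.compContinuousLinearMap (T : E →L[ℝ] E')) b :=
    ⟨fun i j ↦ by rw [hpair, hb'.inl_inl], fun i j ↦ by rw [hpair, hb'.inr_inr], fun i j ↦ by rw [hpair, hb'.inl_inr]⟩
  ext w
  rw [hb.lefschetzDual_apply_apply, ContinuousAlternatingMap.compContinuousLinearMap_apply, hb'.lefschetzDual_apply_apply]
  refine Finset.sum_congr rfl fun i _ ↦ ?_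
  rw [ContinuousAlternatingMap.compContinuousLinearMap_apply]
  congr 1
  funext k
  refine Fin.cases ?_ (fun k ↦ Fin.cases ?_ (fun k ↦ ?_) k) k
  · simp [hbT]
  · simp [hbT]
  · rfl

end Functoriality

/-! ## §2 `Λ_η(φ_H^* y) = φ_H^*(Λ_{E^*} y)` -/

section PhiH

variable {ι : Type*} [Fintype ι] [DecidableEq ι] {E : Type uE} [NormedAddCommGroup E] [NormedSpace ℂ E]
  [FiniteDimensional ℂ E] [FiniteDimensional ℂ (E →L⋆[ℂ] ℂ)] (Φ : (ι → ℝ) ≃L[ℝ] E) {η : E [⋀^Fin 2]→L[ℝ] ℝ}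

omit [FiniteDimensional ℂ E] [FiniteDimensional ℂ (E →L⋆[ℂ] ℂ)] in
/-- `E^*` is non-degenerate on `Ω̄` (`E^*(φ_H u, φ_H v) = E(u, v)` and `φ_H` is onto). [cite: Lang1982AbelianFunctions, Ch. VII §5 Thm. 5.2 (pp. 119–120)] -/
theorem IsRiemannForm.dualForm_exists_apply_ne_zero (hη : IsRiemannForm Φ η) (ξ : E →L⋆[ℂ] ℂ) (hξ : ξ ≠ 0) :
    ∃ ζ : E →L⋆[ℂ] ℂ, dualForm Φ hη.1 hη.nondegenerate ![ξ, ζ] ≠ 0 := by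
  obtain ⟨v, rfl⟩ := (phiHEquiv Φ hη.1 hη.nondegenerate).surjective ξ
  have hv : v ≠ 0 := fun h ↦ hξ (by rw [h, map_zero])
  obtain ⟨w, hw⟩ := hη.exists_apply_ne_zero Φ v hv
  exact ⟨phiHEquiv Φ hη.1 hη.nondegenerate w, by rwa [phiHEquiv_apply, phiHEquiv_apply, dualForm_apply_phiHFun]⟩

omit [FiniteDimensional ℂ E] [FiniteDimensional ℂ (E →L⋆[ℂ] ℂ)] in
/-- `φ_H^* E^* = E` as real `2`-forms (Lang's transport, read through the real-linear analytic representation `φ_H : E → Ω̄` of `φ_L`,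
`(phiHRep Φ _).restrictScalars ℝ`). [cite: Lang1982AbelianFunctions, Ch. VII §5 Thm. 5.2 (pp. 119–120)] [cite: Lange2023AbelianVarietiesComplex, §1.4.2 Lemma 1.4.5] -/
theorem IsRiemannForm.dualForm_compContinuousLinearMap_phiHRep (hη : IsRiemannForm Φ η) :
    (dualForm Φ hη.1 hη.nondegenerate).compContinuousLinearMap ((phiHRep Φ hη.1).restrictScalars ℝ) = η := by
  ext v
  rw [ContinuousAlternatingMap.compContinuousLinearMap_apply]
  have hv : (⇑((phiHRep Φ hη.1).restrictScalars ℝ) ∘ v) = ![phiHFun η (v 0), phiHFun η (v 1)] := by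
    funext k
    refine Fin.cases ?_ (fun k ↦ Fin.cases ?_ (fun k ↦ k.elim0) k) k
    · rfl
    · rfl
  rw [hv, dualForm_apply_phiHFun]
  congr 1
  funext k
  refine Fin.cases rfl (fun k ↦ Fin.cases rfl (fun k ↦ k.elim0) k) k

/-- **`Λ_η(φ_H^* y) = φ_H^*(Λ_{E^*} y)`: the dual Lefschetz operators of `(X, E)` and `(X̂, E^*)` correspond under `φ_L`** (whose analytic
representation is the real-linear isomorphism `φ_H : E ⥲ Ω̄`, `φ_H^* E^* = E`), for every Riemann form `E` and every `y ∈ H^{m+2}(X̂, ℂ)`.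
[cite: Voisin2002, §6.2.1 Lemma 6.19] [cite: Lange2023AbelianVarietiesComplex, §1.4.2 Lemma 1.4.5] [cite: Lang1982AbelianFunctions, Ch. VII §5 Thm. 5.2] -/
theorem IsRiemannForm.lefschetzDual_compContinuousLinearMap_phiHRep (hη : IsRiemannForm Φ η) {m : ℕ}
    (y : (E →L⋆[ℂ] ℂ) [⋀^Fin (m + 2)]→L[ℝ] ℂ) :
    lefschetzDual η m (y.compContinuousLinearMap ((phiHRep Φ hη.1).restrictScalars ℝ)) =
      (lefschetzDual (dualForm Φ hη.1 hη.nondegenerate) m y).compContinuousLinearMap ((phiHRep Φ hη.1).restrictScalars ℝ) := by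
  -- `φ_H` as a real-linear continuous ISOMORPHISM
  let T : E ≃L[ℝ] (E →L⋆[ℂ] ℂ) :=
    ((phiHEquiv Φ hη.1 hη.nondegenerate).toLinearEquiv.restrictScalars ℝ).toContinuousLinearEquiv
  have hTS : (T : E →L[ℝ] (E →L⋆[ℂ] ℂ)) = (phiHRep Φ hη.1).restrictScalars ℝ :=
    ContinuousLinearMap.ext fun v ↦ rfl
  have h := lefschetzDual_compContinuousLinearMap_equiv (hη.dualForm_exists_apply_ne_zero Φ) T y
  rw [hTS, hη.dualForm_compContinuousLinearMap_phiHRep Φ] at h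
  exact h

end PhiH

/-! ## §3 Principal polarisations: `[H^{b+2}(X, ℤ) : θ ∪ Hᵇ(X, ℤ)] = [Hᵐ(X, ℤ) : Λ_θ(H^{m+2}(X, ℤ))]` -/

section Principal

variable {ι : Type*} [Fintype ι] [LinearOrder ι] {E : Type uE} [NormedAddCommGroup E] [NormedSpace ℂ E]
  [FiniteDimensional ℂ E] [FiniteDimensional ℂ (E →L⋆[ℂ] ℂ)] (Φ : (ι → ℝ) ≃L[ℝ] E) {η : E [⋀^Fin 2]→L[ℝ] ℝ}

/-- **THE COKERNELS OF `L_θ` AND `Λ_θ` ON THE INTEGRAL COHOMOLOGY OF A PRINCIPALLY POLARISED TORUS HAVE THE SAME ORDER IN COMPLEMENTARY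
DEGREES: `[H^{b+2}(X, ℤ) : θ ∪ Hᵇ(X, ℤ)] = [Hᵐ(X, ℤ) : Λ_θ(H^{m+2}(X, ℤ))]`** (`b + 2 + m = 2g`, `g ≥ 2`, any lattice basis, any frame;
relative indices, `0` if infinite). The Fourier transform gives `[H^{b+2}(X, ℤ) : θ ∪ Hᵇ(X, ℤ)] = [Hᵐ(X̂, ℤ) : d₁d_g·Λ_{E_δ}(H^{m+2}(X̂, ℤ))]`
(row g50-#7); for the type `(1, …, 1)` the dual polarisation is `E_δ = E^*`, `φ_L = ρ(ᵗG)` is an isomorphism `X ⥲ X̂` (`det G = 1`,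
`φ_L^* H•(X̂, ℤ) = H•(X, ℤ)`), and `Λ_θ ∘ φ_L^* = φ_L^* ∘ Λ_{E^*}` (§2).
[cite: Polishchuk2007FourierStable, §1 (p. 3)] [cite: Lange2023AbelianVarietiesComplex, §6.2.4 Prop. 6.2.20 (p. 310); §2.4.1; §1.4.2 Lemma 1.4.5, Prop. 1.4.7]
[cite: Voisin2002, §6.2.1 Lemma 6.19; §7.1.2] -/
theorem IsPrincipalPolarization.relIndex_map_lefschetzPow_eq_relIndex_map_lefschetzDual (hp : IsPrincipalPolarization Φ η)
    (hg : 4 ≤ Fintype.card ι) {b m : ℕ} (hL : 2 * 1 + b = 2 + b) (e_F : Fin ((2 + b) + m) ≃ ι) :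
    ((integralForms Φ b).map (lefschetzPow η 1 hL).toAddMonoidHom).relIndex (integralForms Φ (2 + b)) =
      ((integralForms Φ (m + 2)).map (lefschetzDual η m).toAddMonoidHom).relIndex (integralForms Φ m) := by
  classical
  obtain ⟨g, d, hd, h1⟩ := hp.exists_type_eq_one
  have hcard := hd.card_eq
  obtain ⟨j, rfl⟩ : ∃ j, g = j + 2 := ⟨g - 2, by omega⟩
  have hη := hp.isRiemannForm
  -- the Fourier side: `[H^{b+2} : θ ∪ Hᵇ] = [Hᵐ(X̂) : D·Λ_{E_δ} H^{m+2}(X̂)]`, with `D = d₁d_g = 1`, `E_δ = E^*`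
  rw [hd.relIndex_map_lefschetzPow_integralForms_eq_dual Φ hη hL e_F]
  have hD : d 0 * d (Fin.last (j + 1)) = 1 := by rw [h1, h1]
  simp only [hD, Nat.cast_one, one_smul]
  -- `φ_L = ρ(ᵗG)` is an isomorphism: `det G = 1`
  obtain ⟨G, hG⟩ := hη.exists_intMatrix_latticeGram
  have hdet : G.transpose.det = 1 := by
    rw [Matrix.det_transpose, hd.det_intGram_eq_sq Φ hG]
    simp [h1]
  have hunit : IsUnit G.transpose.det := by rw [hdet]; exact isUnit_one
  have hBA : G.transpose⁻¹ * G.transpose = 1 := Matrix.nonsing_inv_mul _ hunit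
  have hAB : G.transpose * G.transpose⁻¹ = 1 := Matrix.mul_nonsing_inv _ hunit
  have hρT : realRep Φ (dualPeriod Φ) G.transpose = (phiHRep Φ hη.1).restrictScalars ℝ := by
    refine ContinuousLinearMap.ext fun v ↦ ?_
    rw [realRep_transposeGram_eq_phiHFun Φ hη.1 hG]
    rfl
  -- `φ_L^*` is injective on forms and carries `H•(X̂, ℤ)` onto `H•(X, ℤ)`
  have hinj : Injective (pullbackAlt (realRep Φ (dualPeriod Φ) G.transpose) m).toAddMonoidHom := fun x y hxy ↦ by
    have h := congrArg (fun z : E [⋀^Fin m]→L[ℝ] ℂ ↦ z.compContinuousLinearMap (realRep (dualPeriod Φ) Φ G.transpose⁻¹)) hxy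
    simpa only [LinearMap.toAddMonoidHom_coe, pullbackAlt_apply,
      compContinuousLinearMap_realRep_realRep (dualPeriod Φ) Φ hAB] using h
  have hK : (integralForms (dualPeriod Φ) m).map (pullbackAlt (realRep Φ (dualPeriod Φ) G.transpose) m).toAddMonoidHom =
      integralForms Φ m := map_pullbackAlt_integralForms_eq Φ (dualPeriod Φ) hBA
  -- `Λ_θ ∘ φ_L^* = φ_L^* ∘ Λ_{E^*}`
  have hH : ((integralForms (dualPeriod Φ) (m + 2)).map
        (lefschetzDual (dualForm Φ hη.1 hη.nondegenerate) m).toAddMonoidHom).map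
          (pullbackAlt (realRep Φ (dualPeriod Φ) G.transpose) m).toAddMonoidHom =
      (integralForms Φ (m + 2)).map (lefschetzDual η m).toAddMonoidHom := by
    rw [AddSubgroup.map_map, ← map_pullbackAlt_integralForms_eq Φ (dualPeriod Φ) hBA (k := m + 2), AddSubgroup.map_map]
    congr 1
    refine AddMonoidHom.ext fun y ↦ ?_
    simp only [AddMonoidHom.coe_comp, comp_apply, LinearMap.toAddMonoidHom_coe, pullbackAlt_apply, hρT]
    exact (hη.lefschetzDual_compContinuousLinearMap_phiHRep Φ y).symm
  rw [← AddSubgroup.relIndex_map_map_of_injective _ _ hinj, hH, hK]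

end Principal

end Literature.Geometry.Kaehler.ComplexTorus

end
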